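import Mathlib
import HarnessLib
import Summits.Ventures.LatticeQCDFlow.Exactness.SU2MaskedKickLayer

/-!
# The refusal rule of the `SU(2)` kick layers is sharp per link: past `|ε|‖J‖ = 1` the kick folds and the layer is not injective

HONEST FRAMING: exact (Metropolis-corrected) sampling algorithms for lattice gauge theory;
figures of merit are autocorrelation/cost numbers at stated couplings and volumes; no
continuum-physics claim.

Venture `LatticeQCDFlow` (cell pub-lqcd), topic `Exactness`; FANOUT row 14 (`eng-flowhmc`, engine
`latflow.fthmc`, family B; the refusal rules `2(d−1)|ε| < 1` of `maps.wilson_flow_lo` and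
`Σ_j |ρ_j| ≤ κ_target < 1` of the residual members; control X-8).  NEW WORK of the cell; nothing
is cited as a fact; no number.  The `SU(2)` counterpart of the U(1) sharpness
`U1MaskedLayerCircleMap.u1Layer_fold_of_one_lt` (GEN-5): row 7's sphere statement
`SphereGeodesicKick.geodesicKick_not_injOn_sphere` (past `c‖J‖ = 1` two distinct unit vectors have
the same kick, E–S census) transported to `SU(2)` by the quaternion coordinates.

* `exists_unit_orthogonal_R4` — every `J ∈ ℝ⁴` has a unit normal (explicit: `(−J₁, J₀, −J₃, J₂)/‖J‖`).
* **`su2Kick_not_injective`** — for `1 < c‖J‖` the single-link kick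
  `U ↦ gaussUnit (geodesicKick c J (vecQuat U))` is NOT injective on `SU(2)`: the certificate
  `|c|‖J‖ ≤ 1` of `SU2KickJacobian.bijective_su2Kick` cannot be relaxed.
* **`su2MaskedKick_not_injective`** — consequently a masked kick layer (any mask, any FROZEN field
  `J`) that violates the refusal rule at ONE active link of ONE configuration (`1 < ε‖J V₀ i₀‖`)
  is not injective on the configuration space — so it has no inverse and no change-of-variables
  certificate: the engine's refusal is necessary at the level of the per-link field strength.
  (For the learned layers `‖J_w‖ ≤ Σ_j|ρ_j|` with equality for aligned staples, so the rule on
  `Σ_j|ρ_j|` is the sharp SUFFICIENT condition uniform in the configuration.)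

NOT CLAIMED: that a specific trained member violates the rule (the engine enforces it by
construction — `SU2ResidualSquash.lean`); anything quantitative.
-/

noncomputable section

namespace Summit.Ventures.LatticeQCDFlow.Exactness

open Real Set InnerProductGeometry Metric WithLp
open Literature.MathematicalPhysics.QuantumFieldTheory
open scoped InnerProductSpace Matrix

/-! ## A unit normal in `ℝ⁴` -/

/-- Every vector of `ℝ⁴` has a unit vector orthogonal to it. -/
theorem exists_unit_orthogonal_R4 (J : R4) : ∃ u : R4, ‖u‖ = 1 ∧ ⟪J, u⟫_ℝ = 0 := by
  rcases eq_or_ne J 0 with rfl | hJ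
  · refine ⟨EuclideanSpace.single 0 1, by simp, by simp⟩
  · set w : R4 := toLp 2 ![-J 1, J 0, -J 3, J 2] with hw
    have hnorm : ‖w‖ = ‖J‖ := by
      have h2 : ‖w‖ ^ 2 = ‖J‖ ^ 2 := by
        rw [EuclideanSpace.real_norm_sq_eq, EuclideanSpace.real_norm_sq_eq, Fin.sum_univ_four,
          Fin.sum_univ_four]
        simp [hw]
        ring
      exact (pow_left_inj₀ (norm_nonneg _) (norm_nonneg _) two_ne_zero).1 h2
    have horth : ⟪J, w⟫_ℝ = 0 := by
      rw [PiLp.inner_apply, Fin.sum_univ_four]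
      simp [hw]
      ring
    have hw0 : ‖w‖ ≠ 0 := by rw [hnorm]; exact norm_ne_zero_iff.2 hJ
    refine ⟨‖w‖⁻¹ • w, ?_, ?_⟩
    · rw [norm_smul, norm_inv, norm_norm, inv_mul_cancel₀ hw0]
    · rw [real_inner_smul_right, horth, mul_zero]

/-! ## The single-link kick folds past `c‖J‖ = 1` -/

/-- **Past `c‖J‖ = 1` the `SU(2)` kick is not injective.**  Transport of
`geodesicKick_not_injOn_sphere` along `gaussUnit : S³ → SU(2)` (`vecQuat ∘ gaussUnit = id` on the
unit sphere). -/
theorem su2Kick_not_injective {c : ℝ} {J : R4} (hκ : 1 < c * ‖J‖) :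
    ¬ Function.Injective (fun U : Matrix.specialUnitaryGroup (Fin 2) ℂ =>
      gaussUnit (geodesicKick c J (vecQuat (U : Matrix (Fin 2) (Fin 2) ℂ)))) := by
  have hJ : J ≠ 0 := by
    intro h
    rw [h, norm_zero, mul_zero] at hκ
    linarith
  obtain ⟨u, hu, hJu⟩ := exists_unit_orthogonal_R4 J
  obtain ⟨x₁, x₂, hx₁, hx₂, hne, heq⟩ := geodesicKick_not_injOn_sphere hJ hu hJu hκ
  have h1 : vecQuat ((gaussUnit x₁ : Matrix.specialUnitaryGroup (Fin 2) ℂ) : Matrix (Fin 2) (Fin 2) ℂ) = x₁ :=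
    vecQuat_gaussUnit_sphere ⟨x₁, mem_sphere_zero_iff_norm.2 hx₁⟩
  have h2 : vecQuat ((gaussUnit x₂ : Matrix.specialUnitaryGroup (Fin 2) ℂ) : Matrix (Fin 2) (Fin 2) ℂ) = x₂ :=
    vecQuat_gaussUnit_sphere ⟨x₂, mem_sphere_zero_iff_norm.2 hx₂⟩
  intro hinj
  have h12 : gaussUnit x₁ = gaussUnit x₂ := by
    apply hinj
    simp only [h1, h2, heq]
  apply hne
  rw [← h1, ← h2, h12]

/-! ## Hence a masked kick layer violating the rule at one link is not injective -/

section Layer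

variable {ι : Type*} (p : ι → Prop) [DecidablePred p]

/-- **A masked `SU(2)` kick layer that violates the refusal rule at one active link of one
configuration is not injective** (any mask; field `J` frozen, i.e. unchanged at active links when
only active links change): two configurations differing only at that link, by two link values
with the same kick, have the same image. -/
theorem su2MaskedKick_not_injective {ε : ℝ}
    (J : (ι → Matrix.specialUnitaryGroup (Fin 2) ℂ) → ι → R4)
    (hJloc : ∀ V W : ι → Matrix.specialUnitaryGroup (Fin 2) ℂ,
      (∀ j, ¬p j → V j = W j) → ∀ i, p i → J V i = J W i)
    {V₀ : ι → Matrix.specialUnitaryGroup (Fin 2) ℂ} {i₀ : ι} (hi₀ : p i₀) (hκ : 1 < ε * ‖J V₀ i₀‖) :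
    ¬ Function.Injective (fun (V : ι → Matrix.specialUnitaryGroup (Fin 2) ℂ) (i : ι) =>
        if p i then gaussUnit (geodesicKick ε (J V i)
          (vecQuat ((V i : Matrix.specialUnitaryGroup (Fin 2) ℂ) : Matrix (Fin 2) (Fin 2) ℂ)))
        else V i) := by
  classical
  obtain ⟨U₁, U₂, hkick, hne⟩ := Function.not_injective_iff.1 (su2Kick_not_injective hκ)
  intro hinj
  -- the two configurations
  set V₁ : ι → Matrix.specialUnitaryGroup (Fin 2) ℂ := Function.update V₀ i₀ U₁ with hV₁
  set V₂ : ι → Matrix.specialUnitaryGroup (Fin 2) ℂ := Function.update V₀ i₀ U₂ with hV₂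
  have hfro₁ : ∀ j, ¬p j → V₁ j = V₀ j := fun j hj => by
    have hji : j ≠ i₀ := by
      rintro rfl
      exact hj hi₀
    rw [hV₁, Function.update_of_ne hji]
  have hfro₂ : ∀ j, ¬p j → V₂ j = V₀ j := fun j hj => by
    have hji : j ≠ i₀ := by
      rintro rfl
      exact hj hi₀
    rw [hV₂, Function.update_of_ne hji]
  have hJ₁ : ∀ i, p i → J V₁ i = J V₀ i := hJloc V₁ V₀ hfro₁
  have hJ₂ : ∀ i, p i → J V₂ i = J V₀ i := hJloc V₂ V₀ hfro₂
  have himg : (fun i : ι => if p i then gaussUnit (geodesicKick ε (J V₁ i)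
        (vecQuat ((V₁ i : Matrix.specialUnitaryGroup (Fin 2) ℂ) : Matrix (Fin 2) (Fin 2) ℂ))) else V₁ i) =
      fun i : ι => if p i then gaussUnit (geodesicKick ε (J V₂ i)
        (vecQuat ((V₂ i : Matrix.specialUnitaryGroup (Fin 2) ℂ) : Matrix (Fin 2) (Fin 2) ℂ))) else V₂ i := by
    funext i
    by_cases hi : p i
    · rw [if_pos hi, if_pos hi, hJ₁ i hi, hJ₂ i hi]
      by_cases hii : i = i₀
      · subst hii
        rw [hV₁, hV₂, Function.update_self, Function.update_self]
        exact hkick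
      · rw [hV₁, hV₂, Function.update_of_ne hii, Function.update_of_ne hii]
    · rw [if_neg hi, if_neg hi, hfro₁ i hi, hfro₂ i hi]
  have hVV : V₁ = V₂ := hinj himg
  apply hne
  have h := congr_fun hVV i₀
  rwa [hV₁, hV₂, Function.update_self, Function.update_self] at h

end Layer

end Summit.Ventures.LatticeQCDFlow.Exactness
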